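/- Width seat `ym-line-cbag-p1-w2` (prover-ym-line-cbag-p1-w2-g4-0), route `ColdBoxAllGroups` (crux items stmt-QuantumFields-22254 /
22255 CLOSED; rung leaf R2xi-G `xiPow_holds` in the tree): hypothesis audit of the rung — the power rate for every compact gauge
group of positive dimension. -/
import Summits.QuantumFields.YangMills.Theorems.ColdBoxAllGroupsBoxFloorDimEPos
import Summits.QuantumFields.YangMills.Theorems.ColdBoxAllGroupsBulkDimEPos
import Summits.QuantumFields.YangMills.Theorems.WeakCouplingRatesCurvatureCorrPowerFloor
import Summits.QuantumFields.YangMills.Theorems.WeakCouplingRatesCalibration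
import Summits.QuantumFields.YangMills.Theorems.EquipartitionCriticalityEquipartitionPinsProbeLiePos
import Summits.QuantumFields.YangMills.Theorems.EquipartitionCriticalityEquipartitionPinsProbeTangentDefs
import Literature.MathematicalPhysics.QuantumLattice.GaugeGroups
import Literature.LinearAlgebra.Matrix.UnitaryGramSchmidtRetraction

/-!
# Route `ColdBoxAllGroups`, the rung WITHOUT simplicity: `ξ(β) ≥ β^ε` for every compact gauge group of positive dimension
# (`U(1)`, `U(N)`, tori, `SO(N)`, non-simple products, … — and every compact simple `G` as before)

Hypothesis audit of the proved rung leaf R2xi-G `WeakCouplingRates.xiPow_holds` (route `ColdBoxAllGroups`: BOX `BoxFloorAllGroups_proof`,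
BULK `BulkAllGroups_proof`, the group-free FLOOR `curvatureCorrPowerFloor_proof` and glue `massGapPowerDecayOf_of_box`).  The two cruxes quantify
over compact SIMPLE `G` (`IsCompactSimpleLieGroup`: connected, non-abelian, simple, linear), but their proofs consume that hypothesis only as
`0 < D = dimE r.ρ` (and `r.N ≠ 0`, which `0 < dimE` implies): see `ColdBoxAllGroupsBoxFloorDimEPos` (BOX) and `ColdBoxAllGroupsBulkDimEPos`
(BULK).  Consequently:
* `boxAndBulk_of_dimE_pos` — for every compact `G` (any Borel structure), every faithful unitary lattice representation `r` with
  `0 < dimE r.ρ` and every ceiling `θ₀ > 0`: exponents `0 < A < θ ≤ θ₀`, a constant `c > 0`, `BoxTwoPointDomination r.ρ A θ c` AND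
  `BulkDominatesBox r.ρ A θ`;
* `massGapPowerDecay_of_dimE_pos` — for every such `(G, r)`: `∃ ε > 0, MassGapPowerDecayOf 4 r.ρ ε` (every torus-limit state of the 4-d
  Wilson theory has RP-spectral mass gap `≤ β^{−ε}` for large `β` — the conclusion of the leaf `XiPow`, with simplicity replaced by positive
  chart dimension);
* `dimE_pos_of_connected_nontrivial` — a CONNECTED NONTRIVIAL compact group has `0 < dimE r.ρ` in every faithful unitary representation
  (von Neumann's chart, as in the tree's `stub_liePos`, with nontriviality in place of non-commutativity); hence
  `massGapPowerDecay_of_connected` — the rung's conclusion for EVERY nontrivial connected compact (linear) group;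
* instances: `massGapPowerDecay_unitaryGroup` — every faithful unitary lattice representation of `U(N+1)` (`N = 0`: compact `U(1)` = lattice
  QED₄, whose weak-coupling phase is massless/Coulomb [Guth 1980, Fröhlich–Spencer 1982] — consistent; `N ≥ 1`: the non-simple `U(N+1)`),
  in particular its defining representation (`massGapPowerDecay_unitaryGroup_defining`); and `massGapPowerDecay_circle` / `massGapPowerDecay_u1Rep`
  — the circle group `U(1) = Circle` with the Literature's one-dimensional `u1Rep` (lattice QED₄); the leaf `XiPow` itself is
  `massGapPowerDecay_of_dimE_pos G r (dimE_pos_of_isCompactSimpleLieGroup G r hG)` (not restated: it is `xiPow_holds`);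
* calibration (the caption «constraint on R2c schemes» of the rung, cf. `WeakCouplingRatesCalibration` §G for `SU(2)`):
  `unit_le_rpow_of_gapInUnits_of_dimE_pos` / `_of_simple` — a unit map `a > 0` carrying a volume-uniform lattice gap (`GapInUnits G r a`, the
  `IR` leg of `BalabanLadder`) satisfies `a β ≤ β^{−ε}/c₁` eventually, now unconditionally for every compact simple `G` and more generally for
  every `(G, r)` with `0 < dimE r.ρ`.
READING.  The rung R2xi-G is a statement of one-scale GAUSSIAN (spin-wave) physics: its proof never uses non-abelian structure, and it holds
verbatim for compact `U(1)`, where the correlation length is in fact infinite at weak coupling.  It therefore cannot distinguish confining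
from non-confining gauge groups — a witness of weakness of the rung (BC5-type), recorded as theorems.  No sorry; no new definition; standard
axioms.  NOT the Yang–Mills mass gap: every statement here is an UPPER bound on lattice mass gaps (RECORD-label rung level); no summit
statement is touched.
-/

set_option autoImplicit false

noncomputable section

open MeasureTheory Filter Topology
open scoped Matrix.Norms.Frobenius
open Literature.MathematicalPhysics Literature.MathematicalPhysics.QuantumFieldTheory
open Literature.MathematicalPhysics.QuantumLattice
open Summit.QuantumFields.YangMills.Theorems.WeakCouplingRates
open Summit.QuantumFields.YangMills.Theorems.FreeEnergyLogCoefficient (dimE)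
open Summit.QuantumFields.YangMills.Cruxes.OSLegsFromFemtoAndGap.DlrCollarTransfer (GapInUnits)

namespace Summit.QuantumFields.YangMills.Theorems.ColdBoxAllGroups

/-! ### §1. BOX ∧ BULK and the power rate for every `(G, r)` with positive chart dimension -/

section DimEPos

variable (G : Type) [Group G] [TopologicalSpace G] [IsTopologicalGroup G] [CompactSpace G] [MeasurableSpace G] [BorelSpace G]
  (r : LatticeRep G)

/-- **The absolute flat-datum comparison for `r.ρ`, in the `∃ θ₀ ∃ κ`-shape consumed by BULK** (`θ₀ = 1/100`, `κ = 9θ`;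
`boxDirichletDominationAbs_of_rep`). -/
theorem boxDirichletDominationAbs_latticeRep :
    ∃ θ₀ : ℝ, 0 < θ₀ ∧ ∀ θ : ℝ, 0 < θ → θ ≤ θ₀ → ∃ κ : ℝ, 8 * θ < κ ∧ ∃ β₀ : ℝ, ∀ β : ℝ, β₀ ≤ β →
      ∀ T : ℕ, T ≤ ⌈β ^ θ⌉₊ →
        |β ^ 2 * boxPlaqCov r.ρ β ⌈β ^ θ⌉₊ T - (dimE r.ρ : ℝ) / 4 * boxDirCircSqCov ⌈β ^ θ⌉₊ T| ≤ β ^ (-κ) :=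
  ⟨1 / 100, by norm_num, fun θ hθ hθ1 => ⟨9 * θ, by linarith,
    boxDirichletDominationAbs_of_rep r.ρ r.continuous r.injective r.mem_unitary hθ hθ1⟩⟩

/-- **BOX ∧ BULK at one common window, every compact `G` and every `r` with `0 < dimE r.ρ`**: for every ceiling `θ₀ > 0` there are
`0 < A < θ ≤ θ₀` and `c > 0` with `BoxTwoPointDomination r.ρ A θ c` and `BulkDominatesBox r.ρ A θ`
(`bulkDominatesBox_of_dimE_pos` under the BOX ceiling `θB = 1/100` of `boxTwoPointDomination_of_dimE_pos`). -/
theorem boxAndBulk_of_dimE_pos (hD : 0 < dimE r.ρ) {θ₀ : ℝ} (hθ₀ : 0 < θ₀) :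
    ∃ A θ c : ℝ, 0 < A ∧ A < θ ∧ θ ≤ θ₀ ∧ 0 < c ∧ BoxTwoPointDomination r.ρ A θ c ∧ BulkDominatesBox r.ρ A θ := by
  have hbox : ∀ A θ : ℝ, 0 < A → A < θ → θ ≤ 1 / 100 → ∃ c : ℝ, 0 < c ∧ BoxTwoPointDomination r.ρ A θ c :=
    fun A θ hA hAθ hθ1 => boxTwoPointDomination_of_dimE_pos r.ρ r.continuous r.injective r.mem_unitary hD hA hAθ hθ1
  obtain ⟨A, θ, hA, hAθ, hθ, hbulk⟩ := bulkDominatesBox_of_dimE_pos G r hD (by norm_num : (0 : ℝ) < 1 / 100) hbox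
    (boxDirichletDominationAbs_latticeRep G r) (min θ₀ (1 / 100)) (lt_min hθ₀ (by norm_num))
  obtain ⟨c, hc, hb⟩ := hbox A θ hA hAθ (hθ.trans (min_le_right _ _))
  exact ⟨A, θ, c, hA, hAθ, hθ.trans (min_le_left _ _), hc, hb, hbulk⟩

/-- **The power rate WITHOUT simplicity.**  For every compact `G` (any Borel structure) and every faithful unitary lattice representation `r`
with positive chart dimension `0 < dimE r.ρ` there is `ε > 0` with `MassGapPowerDecayOf 4 r.ρ ε`: for all large `β`, every infinite-volume
torus-limit state of the four-dimensional Wilson theory has RP-spectral mass gap `≤ β^{−ε}` — the conclusion of the leaf `XiPow` for this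
`(G, r)` (glue `massGapPowerDecayOf_of_box` with `ε = A/2`, BOX ∧ BULK from `boxAndBulk_of_dimE_pos`, FLOOR `curvatureCorrPowerFloor_proof`).
NOT THE CLAY GAP (an upper bound on the gap). -/
theorem massGapPowerDecay_of_dimE_pos (hD : 0 < dimE r.ρ) : ∃ ε : ℝ, 0 < ε ∧ MassGapPowerDecayOf 4 r.ρ ε := by
  obtain ⟨A, θ, c, hA, -, -, hc, hbox, hbulk⟩ := boxAndBulk_of_dimE_pos G r hD one_pos
  exact ⟨A / 2, by linarith, massGapPowerDecayOf_of_box r.ρ r.continuous hA hc hbox hbulk curvatureCorrPowerFloor_proof⟩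

/-- **Calibration without simplicity** («constraint on R2c schemes», cf. `su2_unit_le_rpow_of_xiPowSU2`): if `0 < dimE r.ρ` and the lattice
theory of `(G, r)` has a volume-uniform gap in the units `a > 0` (`GapInUnits G r a`, the `IR` leg of `BalabanLadder`), then
`a β ≤ β^{−ε} / c₁` for all large `β` (`unit_le_rpow_of_gapInUnits` with XI-POW discharged by `massGapPowerDecay_of_dimE_pos`).
NOT THE CLAY GAP. -/
theorem unit_le_rpow_of_gapInUnits_of_dimE_pos (hD : 0 < dimE r.ρ) {a : ℝ → ℝ} (ha : ∀ β, 0 < a β) (hgap : GapInUnits G r a) :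
    ∃ ε c₁ : ℝ, 0 < ε ∧ 0 < c₁ ∧ ∀ᶠ β : ℝ in atTop, a β ≤ β ^ (-ε) / c₁ := by
  obtain ⟨ε, hε, hpow⟩ := massGapPowerDecay_of_dimE_pos G r hD
  obtain ⟨c₁, hc₁, h⟩ := unit_le_rpow_of_gapInUnits r ha hgap hpow
  exact ⟨ε, c₁, hε, hc₁, h⟩

end DimEPos

/-! ### §2. Positive chart dimension: every nontrivial connected compact (linear) group -/

/-- **A connected nontrivial compact group has positive chart dimension in every faithful unitary matrix representation.**  If
`D = dimE r.ρ = dim_ℝ span{X | exp(tX) ∈ r(G) ∀ t}` (`dimE_eq_lieDim`) were `0`, every one-parameter generator of `r(G)` would vanish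
and von Neumann's exponential chart (`LiePos.exists_ball_eq_singleton`) would make `{1}` open in `G`, hence clopen, hence all of the
connected `G` — contradicting `Nontrivial G`.  (The tree's `stub_liePos` / `dimE_pos_of_isCompactSimpleLieGroup` is the case of a compact
SIMPLE `G`, where non-commutativity supplies the nontriviality.) -/
theorem dimE_pos_of_connected_nontrivial (G : Type) [Group G] [TopologicalSpace G] [CompactSpace G] [ConnectedSpace G]
    [Nontrivial G] (r : LatticeRep G) : 0 < dimE r.ρ := by
  rw [Summit.QuantumFields.YangMills.Theorems.EquipartitionPinsProbe.dimE_eq_lieDim r]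
  refine Nat.pos_of_ne_zero fun h0 => ?_
  rw [Submodule.finrank_eq_zero, Submodule.span_eq_bot] at h0
  obtain ⟨ε, hε, hball⟩ :=
    Summit.QuantumFields.YangMills.Theorems.EquipartitionPinsProbe.LiePos.exists_ball_eq_singleton r (fun X hX => h0 X hX)
  haveI : T2Space G := T2Space.of_injective_continuous r.injective r.continuous
  have hopen : IsOpen ({1} : Set G) := by
    rw [← hball]
    exact isOpen_lt (continuous_norm.comp (r.continuous.sub continuous_const)) continuous_const
  have hclopen : IsClopen ({1} : Set G) := ⟨isClosed_singleton, hopen⟩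
  have huniv : ({1} : Set G) = Set.univ := hclopen.eq_univ (Set.singleton_nonempty 1)
  obtain ⟨g, hg⟩ := exists_ne (1 : G)
  have : g ∈ ({1} : Set G) := huniv ▸ Set.mem_univ g
  exact hg (by simpa using this)

/-- **The power rate for EVERY nontrivial connected compact (linear) gauge group.**  For every compact connected nontrivial `G` (any Borel
structure) and every faithful unitary lattice representation `r` there is `ε > 0` with `MassGapPowerDecayOf 4 r.ρ ε`.  This covers `U(1)`,
tori, `U(N)`, `SO(N)`, `Spin(N)`, every compact simple `G`, and all their products and quotients alike: the rung R2xi-G never sees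
non-abelian structure.  NOT THE CLAY GAP (an upper bound on the gap). -/
theorem massGapPowerDecay_of_connected (G : Type) [Group G] [TopologicalSpace G] [IsTopologicalGroup G] [CompactSpace G]
    [ConnectedSpace G] [Nontrivial G] [MeasurableSpace G] [BorelSpace G] (r : LatticeRep G) :
    ∃ ε : ℝ, 0 < ε ∧ MassGapPowerDecayOf 4 r.ρ ε :=
  massGapPowerDecay_of_dimE_pos G r (dimE_pos_of_connected_nontrivial G r)

/-- **Calibration for every compact simple `G`, unconditionally** (the `SU(2)` caption `su2_unit_le_rpow_of_xiPowSU2` of rung R2ξ, now for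
the all-`G` rung R2xi-G and without the `XiPow` hypothesis): a unit map `a > 0` in which the lattice theory of `(G, r)` has a volume-uniform
gap satisfies `a β ≤ β^{−ε} / c₁` eventually.  NOT THE CLAY GAP. -/
theorem unit_le_rpow_of_gapInUnits_of_simple (G : Type) [Group G] [TopologicalSpace G] [IsTopologicalGroup G] [CompactSpace G]
    (hG : IsCompactSimpleLieGroup G) :
    letI : MeasurableSpace G := borel G
    haveI : BorelSpace G := ⟨rfl⟩
    ∀ (r : LatticeRep G) (a : ℝ → ℝ), (∀ β, 0 < a β) → GapInUnits G r a →
      ∃ ε c₁ : ℝ, 0 < ε ∧ 0 < c₁ ∧ ∀ᶠ β : ℝ in atTop, a β ≤ β ^ (-ε) / c₁ := by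
  letI : MeasurableSpace G := borel G
  haveI : BorelSpace G := ⟨rfl⟩
  intro r a ha hgap
  exact unit_le_rpow_of_gapInUnits_of_dimE_pos G r
    (Summit.QuantumFields.YangMills.Cruxes.NT.LinkEquipartition.dimE_pos_of_isCompactSimpleLieGroup G r hG) ha hgap

/-! ### §3. Instances: the unitary groups `U(N+1)` (compact `U(1)` = lattice QED₄ at `N = 0`; non-simple for every `N`) -/

/-- `U(N+1)` is nontrivial: `−1 ≠ 1`. -/
theorem nontrivial_unitaryGroup (N : ℕ) : Nontrivial (Matrix.unitaryGroup (Fin (N + 1)) ℂ) := by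
  refine ⟨⟨1, -1, fun h => ?_⟩⟩
  have h' := congrArg (fun U : Matrix.unitaryGroup (Fin (N + 1)) ℂ => (U : Matrix (Fin (N + 1)) (Fin (N + 1)) ℂ) 0 0) h
  simp only [Unitary.coe_neg] at h'
  norm_num at h'

/-- **The power rate for every faithful unitary lattice representation of `U(N+1)`** (connected: the tree's
`pathConnectedSpace_unitaryGroup`; compact and Borel: `GaugeGroups`).  At `N = 0` this is compact `U(1)` lattice gauge theory (lattice
QED₄), whose weak-coupling phase is massless — consistent with, and invisible to, the rung.  NOT THE CLAY GAP. -/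
theorem massGapPowerDecay_unitaryGroup (N : ℕ) (r : LatticeRep (Matrix.unitaryGroup (Fin (N + 1)) ℂ)) :
    ∃ ε : ℝ, 0 < ε ∧ MassGapPowerDecayOf 4 r.ρ ε := by
  haveI := nontrivial_unitaryGroup N
  exact massGapPowerDecay_of_connected _ r

/-- **The power rate for the defining representation of `U(N+1)`** (`unitaryFundamentalRep`, a faithful continuous unitary lattice
representation): `∃ ε > 0, MassGapPowerDecayOf 4 (unitaryFundamentalRep (Fin (N+1)) ℂ) ε`.  NOT THE CLAY GAP. -/
theorem massGapPowerDecay_unitaryGroup_defining (N : ℕ) :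
    ∃ ε : ℝ, 0 < ε ∧ MassGapPowerDecayOf 4 (G := Matrix.unitaryGroup (Fin (N + 1)) ℂ) (unitaryFundamentalRep (Fin (N + 1)) ℂ) ε :=
  massGapPowerDecay_unitaryGroup N
    ⟨N + 1, unitaryFundamentalRep (Fin (N + 1)) ℂ, continuous_unitaryFundamentalRep _ _, unitaryFundamentalRep_injective _ _,
      fun U => by rw [unitaryFundamentalRep_apply]; exact U.prop⟩

/-! ### §4. Instance: `U(1) = Circle` with its one-dimensional representation `u1Rep` (`GaugeGroups`) -/

/-- The circle group is nontrivial: `e^{iπ} = −1 ≠ 1`. -/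
theorem nontrivial_circle : Nontrivial Circle := by
  refine ⟨⟨Circle.exp Real.pi, 1, fun h => ?_⟩⟩
  have h' := congrArg (fun z : Circle => (z : ℂ)) h
  simp only [Circle.coe_exp, Circle.coe_one] at h'
  have : Complex.exp (Real.pi * Complex.I) = -1 := Complex.exp_pi_mul_I
  rw [this] at h'
  norm_num at h'

/-- **The power rate for every faithful unitary lattice representation of the circle group `U(1)`** (connected and compact: Mathlib; any
Borel structure).  Compact `U(1)` lattice gauge theory in four dimensions has a massless Coulomb phase at weak coupling
[Guth 1980; Fröhlich–Spencer 1982], so its correlation length is infinite there — the rung's `ξ ≥ β^ε` holds and sees nothing of it.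
NOT THE CLAY GAP. -/
theorem massGapPowerDecay_circle [MeasurableSpace Circle] [BorelSpace Circle] (r : LatticeRep Circle) :
    ∃ ε : ℝ, 0 < ε ∧ MassGapPowerDecayOf 4 r.ρ ε := by
  haveI := nontrivial_circle
  exact massGapPowerDecay_of_connected _ r

/-- **The power rate for lattice QED₄: `U(1) = Circle` in its defining one-dimensional representation `u1Rep`** (`GaugeGroups`:
`u1Rep z = (z)`, continuous, faithful, unitary).  NOT THE CLAY GAP. -/
theorem massGapPowerDecay_u1Rep [MeasurableSpace Circle] [BorelSpace Circle] :
    ∃ ε : ℝ, 0 < ε ∧ MassGapPowerDecayOf 4 (G := Circle) u1Rep ε :=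
  massGapPowerDecay_circle ⟨1, u1Rep, continuous_u1Rep, u1Rep_injective, u1Rep_mem_unitaryGroup⟩

/-! ## Appended 2026-08-28 (same seat): the lower rung XI-DIV without simplicity

`MassGapPowerDecayOf 4 ρ ε` with `ε > 0` implies `MassGapVanishesOf 4 ρ` (`β^{−ε} → 0`), so the PROVED rung `XiDiv`
(`massGapVanishesOf_allSimpleG`, stated for compact simple `G`) also holds for every `(G, r)` with `0 < dimE r.ρ`, hence for every
nontrivial connected compact (linear) gauge group, and for `U(1)`; and the calibration `tendsto_zero_of_gapInUnits` (§E/§F of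
`WeakCouplingRatesCalibration`) becomes unconditional for all of them.  NOT THE CLAY GAP. -/

section XiDiv

variable {N : ℕ} {G : Type} [Group G] [TopologicalSpace G] [IsTopologicalGroup G] [CompactSpace G]
  [MeasurableSpace G] [BorelSpace G]

/-- **XI-POW(ε) ⇒ XI-DIV**: a power rate `β^{−ε}`, `ε > 0`, on the RP-spectral gaps of the torus-limit states forces them below every
fixed `η > 0` eventually (`massGapUpperRateOf_mono`, `β^{−ε} → 0`). -/
theorem massGapVanishesOf_of_powerDecay (ρ : G →* Matrix (Fin N) (Fin N) ℂ) {ε : ℝ} (hε : 0 < ε)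
    (h : MassGapPowerDecayOf 4 ρ ε) : MassGapVanishesOf 4 ρ := by
  intro η hη
  refine massGapUpperRateOf_mono ρ ?_ h
  have ht : Tendsto (fun β : ℝ => β ^ (-ε)) atTop (𝓝 0) := tendsto_rpow_neg_atTop hε
  exact (ht.eventually (Iic_mem_nhds hη)).mono fun β hβ => hβ

/-- **XI-DIV without simplicity**: for every compact `G` and every `r : LatticeRep G` with `0 < dimE r.ρ`, `MassGapVanishesOf 4 r.ρ` — for
every `η > 0` and all large `β` no torus-limit state has RP-spectral gap `> η` (the rung `XiDiv` with simplicity replaced by positive chart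
dimension).  NOT THE CLAY GAP. -/
theorem massGapVanishes_of_dimE_pos (G : Type) [Group G] [TopologicalSpace G] [IsTopologicalGroup G] [CompactSpace G]
    [MeasurableSpace G] [BorelSpace G] (r : LatticeRep G) (hD : 0 < dimE r.ρ) : MassGapVanishesOf 4 r.ρ := by
  obtain ⟨ε, hε, h⟩ := massGapPowerDecay_of_dimE_pos G r hD
  exact massGapVanishesOf_of_powerDecay r.ρ hε h

/-- **XI-DIV for every nontrivial connected compact (linear) gauge group.**  NOT THE CLAY GAP. -/
theorem massGapVanishes_of_connected (G : Type) [Group G] [TopologicalSpace G] [IsTopologicalGroup G] [CompactSpace G]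
    [ConnectedSpace G] [Nontrivial G] [MeasurableSpace G] [BorelSpace G] (r : LatticeRep G) : MassGapVanishesOf 4 r.ρ :=
  massGapVanishes_of_dimE_pos G r (dimE_pos_of_connected_nontrivial G r)

/-- **XI-DIV for lattice QED₄** (`U(1) = Circle`, `u1Rep`).  NOT THE CLAY GAP. -/
theorem massGapVanishes_u1Rep [MeasurableSpace Circle] [BorelSpace Circle] : MassGapVanishesOf 4 (G := Circle) u1Rep := by
  obtain ⟨ε, hε, h⟩ := massGapPowerDecay_u1Rep
  exact massGapVanishesOf_of_powerDecay u1Rep hε h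

/-- **A unit map carrying a volume-uniform lattice gap tends to zero — without simplicity** (`tendsto_zero_of_gapInUnits` with XI-DIV
discharged by `massGapVanishes_of_dimE_pos`; cf. `tendsto_zero_of_gapInUnits_of_simple`): for every compact `G`, every `r` with
`0 < dimE r.ρ` and every `a > 0` with `GapInUnits G r a`, `a(β) → 0`.  NOT THE CLAY GAP. -/
theorem tendsto_zero_of_gapInUnits_of_dimE_pos (G : Type) [Group G] [TopologicalSpace G] [IsTopologicalGroup G] [CompactSpace G]
    [MeasurableSpace G] [BorelSpace G] (r : LatticeRep G) (hD : 0 < dimE r.ρ) {a : ℝ → ℝ} (ha : ∀ β, 0 < a β)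
    (hgap : GapInUnits G r a) : Tendsto a atTop (𝓝 0) :=
  tendsto_zero_of_gapInUnits r ha hgap (massGapVanishes_of_dimE_pos G r hD)

end XiDiv

end Summit.QuantumFields.YangMills.Theorems.ColdBoxAllGroups

end
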